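import Summits.AtomisticToContinuum.HydrodynamicLimit.Theses.AntiMazurCoboundaries
import Summits.AtomisticToContinuum.HydrodynamicLimit.Theorems.BoltzmannGreenKubo.Negative.Stationarity
import HarnessLib

/-!
# `HomogeneousInvariance` (support item stmt-AtomisticToContinuum-9621): the constant-profile
# local Gibbs law is invariant under every hard-sphere flow

The shared support item `HomogeneousInvariance` (stmt-AtomisticToContinuum-9621, = stmt-3073 verbatim),
wanted by the routes `AntiMazurCoboundaries`, `CramerEdgeLadder`, `RingDensityCertificate`,
`OneSphereInfluence` and `CramerRaoSaturation` of the sub-problem `HydrodynamicLimit`: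
for constant profiles `(a₀, u₀, θ₀) ≡ (c, uc, θc)` the local Gibbs law
`G_N = localGibbsLaw σ c uc θc N Φ` — the canonical (homogeneous) Gibbs law of `N + 1` hard spheres
of diameter `hsDiameter σ N` on `𝕋³` — satisfies `Φ.lawAt G_N t = G_N` for EVERY hard-sphere flow `Φ`
and every time `t` (no positivity or normalisation hypothesis is needed; the hypotheses
`0 < σ, 0 < c, 0 < θc` of the item are not used).

Proof: `Φ.lawAt G_N t = (Φ.flow t)_# G_N` (`HardSphereFlow.lawAt_eq`), and `(Φ_t)_# G_N = G_N` is the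
tree theorem `BoltzmannGreenKuboOrthMomentum.map_flow_localGibbsLaw_const`
(`Theorems/BoltzmannGreenKubo/Negative/Stationarity.lean`): Liouville's theorem
(`HardSphereFlow.measurePreserving`, GST 2013 Prop. 4.1.1) plus invariance of the canonical density on
the conull good set — the density is a function of `Σᵢ ‖vᵢ − uc‖² = 2E − 2⟪P, uc⟫ + (N+1)‖uc‖²`,
conserved along good orbits by energy and momentum conservation
(`HardSphereFlow.configEnergy_flow`, `HardSphereFlow.configMomentum_flow`).

The deciding theorem is `homogeneousInvariance_proof` (route `AntiMazurCoboundaries`, by name); the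
four other wanting routes state the item with the identical body, so the same term closes their decls
by definitional unfolding (`exact homogeneousInvariance_proof`).

References: H. Spohn, *Large Scale Dynamics of Interacting Particles* (1991), Part I §2.3;
I. Gallagher, L. Saint-Raymond, B. Texier, *From Newton to Boltzmann* (2013), Prop. 4.1.1;
C. Cercignani, R. Illner, M. Pulvirenti, *The Mathematical Theory of Dilute Gases* (1994), §4.2.
-/

noncomputable section

namespace Summit.AtomisticToContinuum.HydrodynamicLimit.Theorems

open MeasureTheory
open Literature.Analysis.FluidPDE Literature.MathematicalPhysics.KineticTheory

/-- **`HomogeneousInvariance` holds** (support item stmt-AtomisticToContinuum-9621, route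
`AntiMazurCoboundaries`, concluded BY NAME): the constant-profile local Gibbs law is invariant under
every hard-sphere flow, `Φ.lawAt G_N t = G_N`. Liouville preservation + energy and momentum
conservation on the good set (`map_flow_localGibbsLaw_const`). [folklore] -/
theorem homogeneousInvariance_proof :
    Summit.AtomisticToContinuum.HydrodynamicLimit.Theses.AntiMazurCoboundaries.HomogeneousInvariance := by
  unfold Summit.AtomisticToContinuum.HydrodynamicLimit.Theses.AntiMazurCoboundaries.HomogeneousInvariance
  intro σ c θc uc _ _ _ N Φ t
  rw [HardSphereFlow.lawAt_eq]
  exact BoltzmannGreenKuboOrthMomentum.map_flow_localGibbsLaw_const c θc uc Φ t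

end Summit.AtomisticToContinuum.HydrodynamicLimit.Theorems

end
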